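import Literature.AnabelianGeometry.EtaleTheta.Discharge.Sec4GaloisSurjResModel
import Literature.AnabelianGeometry.SemiGraphs.TemperoidsHomEqResProofs

/-!
# [SemiAnbd] Prop. 3.2 for an EQUIVALENCE `B^temp(Π₁) ≌ B^temp(Π₂)`: `Ψ^bs ≅ B^temp(φ)` for an ISOMORPHISM `φ`
# of tempered groups, and the transport of Galois objects / Galois surjections / kernels along isomorphisms

S. Mochizuki, *Semi-graphs of anabelioids*, Publ. RIMS **42** (2006) [MochizukiSemiAnbd2006], Prop. 3.2 p.35: «the
category of morphisms `B^temp(Π₁) → B^temp(Π₂)` is equivalent to the category whose objects are continuous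
homomorphisms `Π₁ → Π₂` and whose morphisms are elements of `Π₂` [conjugating one into the other]»; in particular
an EQUIVALENCE of connected temperoids `B^temp(Π₁) ⥲ B^temp(Π₂)` is `B^temp(φ)` for a continuous ISOMORPHISM
`φ`, well defined up to inner automorphism (Rmk. 3.2.1 p.35: «it makes sense to write `π₁^temp(X)`»).
S. Mochizuki, *The étale theta function …*, Publ. RIMS **45** (2009) [MochizukiEtTh2009], Thm. 4.4 (i), proof p.321
(PDF p.95) ll.5–6: «The portion of assertion (i) concerning `Ψ^bs` follows immediately from the theory of
temperoids [cf. [SemiAnbd], Proposition 3.2; Theorem A.4]».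

abc-iut cell, layer L2, ROW «SUBDAG-EtTh-Thm44 T44-L09 / T44-L09c AT THE TEMPEROID BASE via [SemiAnbd] Prop. 3.2»
(abc-iut-L2-lead gen 3 RULINGS #10 (05:24Z); seat abc-iut-w5-d013 gen 3), FILE 1 of 2 — the BRIDGE, over abc-iut-L3's
vocabulary (`BTemp`, `BTemp.res`, `IsGaloisObj`) and the DISCHARGED Prop. 3.2 of abc-iut-L3-d2
(`TemperoidHomEqRes_holds`, `BTemp.exists_conj_of_natTrans`):
* `BTemp.exists_res_iso_of_equivalence` — for tempered, second-countable `Π₁`, `Π₂` and an equivalence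
  `E : B^temp(Π₁) ≌ B^temp(Π₂)` there are MUTUALLY INVERSE continuous homomorphisms `φ : Π₂ → Π₁`, `ψ : Π₁ → Π₂`
  with `E.functor ≅ B^temp(φ)` and `E.inverse ≅ B^temp(ψ)` (the chart-free twin of abc-iut-L3's
  `TemperedPiChart.exists_compatIso`, whose proof pattern is followed verbatim: Prop. 3.2 surjectivity twice,
  then the injectivity half corrects the second homomorphism by an inner automorphism);
* `GaloisObjects.isGaloisObj_of_iso`, `GaloisObjects.ker_galoisSurjOf_eq_of_iso`,
  `GaloisObjects.galoisSurjOf_iso_conj` — Galois objects, the kernels `N_A = Ker(Π ↠ Aut(A))` and (up to an inner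
  automorphism) the Galois surjections `galoisSurjOf` of `Sec4GaloisSurjNaturalModel` are invariant under
  isomorphism in `B^temp(Π)`;
* `GaloisObjects.isGaloisObj_of_iso_res`, `…ker_galoisSurjOf_of_iso_res`, `…galoisSurjOf_of_iso_res` — the same
  three transports along ANY functor `F ≅ B^temp(φ)` (`φ` a continuous surjection), combining the above with
  gen 2's `isGaloisObj_res` / `ker_galoisSurjOf_res` / `galoisSurjOf_res` (`Sec4GaloisSurjResModel`).
FILE 2 (`Sec4Thm44GaloisCompatibleOfTemperoid`) feeds these into abc-iut-L2-t3's `Thm44Hyp` at settings whose base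
category IS `B^temp(Π^tp_X)` (abc-iut-L2-t4's `BiKummerSetting.mkOfTemperoid`).  Proof-only, no definition; nothing here bears on [IUTchIII] Cor. 3.12 (refereed pre-IUT material).
-/

noncomputable section

open CategoryTheory CategoryTheory.Limits Topology

namespace Literature.AnabelianGeometry.SemiGraphs

universe u

namespace BTemp

variable {G₁ : Type u} [Group G₁] [TopologicalSpace G₁] {G₂ : Type u} [Group G₂] [TopologicalSpace G₂]

/-- **[SemiAnbd] Prop. 3.2 for an equivalence: `E ≅ B^temp(φ)` with `φ` an ISOMORPHISM of topological groups.**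
For tempered, Galois-countable `Π₁`, `Π₂` and an equivalence of categories `E : B^temp(Π₁) ≌ B^temp(Π₂)` there are
mutually inverse continuous homomorphisms `φ : Π₂ → Π₁`, `ψ : Π₁ → Π₂` with `E.functor ≅ B^temp(φ)` and
`E.inverse ≅ B^temp(ψ)`.  (Surjectivity half `TemperoidHomEqRes_holds` applied to `E.functor` and to `E.inverse`
— an equivalence preserves all limits and colimits, so both are morphisms of temperoids —, then
`B^temp(ψ₀ ∘ φ) ≅ E.functor ⋙ E.inverse ≅ 𝟭` forces `φ ∘ ψ₀` and `ψ₀ ∘ φ` to be inner (`exists_conj_of_natTrans`),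
and `ψ := ψ₀ ∘ γ_g` is a genuine inverse.) [cite: MochizukiSemiAnbd2006, Prop 3.2 p.35] -/
theorem exists_res_iso_of_equivalence [IsTopologicalGroup G₁] [IsTopologicalGroup G₂]
    [SecondCountableTopology G₁] [SecondCountableTopology G₂] (h₁ : IsTempered G₁) (h₂ : IsTempered G₂)
    (E : BTemp G₁ ≌ BTemp G₂) :
    ∃ (φ : G₂ →ₜ* G₁) (ψ : G₁ →ₜ* G₂), (∀ x, ψ (φ x) = x) ∧ (∀ y, φ (ψ y) = y) ∧
      Nonempty (E.functor ≅ BTemp.res φ) ∧ Nonempty (E.inverse ≅ BTemp.res ψ) := by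
  -- the natural transformation `𝟭 ⟶ B^temp(id)` (componentwise the identity) and conjugation as a continuous hom
  -- (adapted from Literature/AnabelianGeometry/SemiGraphs/TemperedChartTransport.lean, where both are private)
  let toResId : ∀ (H : Type u) [Group H] [TopologicalSpace H],
      (𝟭 (BTemp H) ⟶ BTemp.res (ContinuousMonoidHom.id H)) := fun H _ _ =>
    { app := fun X => BTemp.homOfEquivariant X ((BTemp.res (ContinuousMonoidHom.id H)).obj X) id fun _ _ => rfl
      naturality := fun X Y f => by
        apply ObjectProperty.hom_ext
        apply Action.Hom.ext
        exact ConcreteCategory.hom_ext _ _ fun _ => rfl }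
  let conjHom : G₁ → (G₁ →ₜ* G₁) := fun g =>
    { toMonoidHom := (MulAut.conj g).toMonoidHom
      continuous_toFun := by
        change Continuous fun x => g * x * g⁻¹
        fun_prop }
  have conjHom_apply : ∀ g x : G₁, conjHom g x = g * x * g⁻¹ := fun _ _ => rfl
  -- Prop. 3.2, surjectivity half, for `E.functor` (a morphism of temperoids `B^temp(Π₂) → B^temp(Π₁)`)
  haveI : PreservesFiniteLimits E.functor := ⟨fun J _ _ => inferInstance⟩
  haveI : PreservesFiniteLimits E.inverse := ⟨fun J _ _ => inferInstance⟩
  let Φ₁ : TemperoidHom (BTemp G₂) (BTemp G₁) := ⟨E.functor, inferInstance, fun J _ _ => inferInstance⟩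
  let Φ₂ : TemperoidHom (BTemp G₁) (BTemp G₂) := ⟨E.inverse, inferInstance, fun J _ _ => inferInstance⟩
  obtain ⟨φ, ⟨iφ⟩⟩ := TemperoidHomEqRes_holds G₂ G₁ h₂ h₁ Φ₁
  obtain ⟨ψ₀, ⟨iψ⟩⟩ := TemperoidHomEqRes_holds G₁ G₂ h₁ h₂ Φ₂
  change E.functor ≅ BTemp.res φ at iφ
  change E.inverse ≅ BTemp.res ψ₀ at iψ
  -- `B^temp(ψ₀ after φ) ≅ functor ⋙ inverse ≅ 𝟭`, hence `φ ∘ ψ₀` is inner (Prop. 3.2, injectivity half)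
  have hinner₁ : ∃ g : G₁, ∀ a : G₁, g * φ (ψ₀ a) * g⁻¹ = a := by
    let i1 : BTemp.res (φ.comp ψ₀) ≅ 𝟭 (BTemp G₁) :=
      (Functor.isoWhiskerRight iφ.symm (BTemp.res ψ₀) ≪≫ Functor.isoWhiskerLeft E.functor iψ.symm :
          BTemp.res φ ⋙ BTemp.res ψ₀ ≅ E.functor ⋙ E.inverse) ≪≫
        E.unitIso.symm
    obtain ⟨g, hg, -⟩ := BTemp.exists_conj_of_natTrans h₁ (φ.comp ψ₀) (ContinuousMonoidHom.id G₁)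
      (i1.hom ≫ toResId G₁)
    exact ⟨g, fun a => by simpa using hg a⟩
  -- symmetrically `ψ₀ ∘ φ` is inner
  have hinner₂ : ∃ g : G₂, ∀ b : G₂, g * ψ₀ (φ b) * g⁻¹ = b := by
    let i2 : BTemp.res (ψ₀.comp φ) ≅ 𝟭 (BTemp G₂) :=
      (Functor.isoWhiskerRight iψ.symm (BTemp.res φ) ≪≫ Functor.isoWhiskerLeft E.inverse iφ.symm :
          BTemp.res ψ₀ ⋙ BTemp.res φ ≅ E.inverse ⋙ E.functor) ≪≫
        E.counitIso
    obtain ⟨g, hg, -⟩ := BTemp.exists_conj_of_natTrans h₂ (ψ₀.comp φ) (ContinuousMonoidHom.id G₂)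
      (i2.hom ≫ toResId G₂)
    exact ⟨g, fun b => by simpa using hg b⟩
  obtain ⟨g, hg⟩ := hinner₁
  obtain ⟨g', hg'⟩ := hinner₂
  -- the corrected inverse `ψ := ψ₀ ∘ conj(g)`
  let ψ : G₁ →ₜ* G₂ := ψ₀.comp (conjHom g)
  have hφψ : ∀ y, φ (ψ y) = y := by
    intro y
    have e1 := hg (g * y * g⁻¹)
    have e2 : φ (ψ₀ (g * y * g⁻¹)) = y := by
      have := congrArg (fun z => g⁻¹ * z * g) e1
      simpa [mul_assoc] using this
    simpa [ψ, conjHom_apply] using e2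
  have hinj : Function.Injective φ := by
    intro b₁ b₂ h
    have := congrArg (fun z => g' * ψ₀ z * g'⁻¹) h
    simpa [hg'] using this
  have hψφ : ∀ x, ψ (φ x) = x := fun x => hinj (hφψ (φ x))
  refine ⟨φ, ψ, hψφ, hφψ, ⟨iφ⟩, ⟨iψ ≪≫ BTemp.resIsoOfConj ψ₀ ψ (ψ₀ g) fun a => ?_⟩⟩
  change ψ₀ g * ψ₀ a * (ψ₀ g)⁻¹ = ψ₀ (g * a * g⁻¹)
  rw [map_mul, map_mul, map_inv]

end BTemp

namespace GaloisObjects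

open Literature.AlgebraicGeometry.Frobenioids (IsConnectedObj)
open Literature.AlgebraicGeometry.Frobenioids.QuasiTemperoid.BTempConnected

variable {G : Type u} [Group G] [TopologicalSpace G] [IsTopologicalGroup G]
  {G₂ : Type u} [Group G₂] [TopologicalSpace G₂] [IsTopologicalGroup G₂]

/-! ### Transport along an isomorphism of `B^temp(Π)` -/

/-- **Galois objects are invariant under isomorphism**: `X ≅ Y`, `Y` Galois ⇒ `X` Galois (`X ≅ Y ≅ Π/N_Y`,
[SemiAnbd] Rmk. 3.1.3). [cite: MochizukiSemiAnbd2006, Def 3.1 (iv) p.33] -/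
theorem isGaloisObj_of_iso (hG : IsTempered G) {X Y : BTemp G} (e : X ≅ Y) (hY : IsGaloisObj Y) :
    IsGaloisObj X :=
  isGaloisObj_of_iso_quotientObj hG X (galoisQuot hG Y hY) (e ≪≫ galoisIso hG Y hY)

/-- **The kernel `N_A = Ker(Π ↠ Aut(A))` of the Galois surjection depends only on the isomorphism class of the
Galois object** (it is the stabiliser of any point, and an isomorphism is an equivariant bijection).
[cite: MochizukiEtTh2009, Def 4.1 (ii) p.313 (PDF p.87)] -/
theorem ker_galoisSurjOf_eq_of_iso (hG : IsTempered G) {X Y : BTemp G} (e : X ≅ Y) (hX : IsGaloisObj X)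
    (hY : IsGaloisObj Y) :
    (galoisSurjOf hG X hX).ker = (galoisSurjOf hG Y hY).ker := by
  ext g
  rw [mem_ker_galoisSurjOf_iff_stab hG X hX (e.inv.hom.hom (galoisBase hG Y hY)) g,
    mem_ker_galoisSurjOf_iff_stab hG Y hY (galoisBase hG Y hY) g]
  constructor
  · intro h
    have h1 := congrArg (fun x : X.obj.V => (e.hom.hom.hom x : Y.obj.V)) h
    simp only at h1
    rwa [hom_ρ, iso_hom_inv_apply] at h1
  · intro h
    rw [← hom_ρ, h]

/-- **The Galois surjections of isomorphic Galois objects agree up to an INNER automorphism**: for `e : X ≅ Y`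
there is `c ∈ Π` with `e⁻¹ ∘ galoisSurjOf_X(g) ∘ e = galoisSurjOf_Y(c g c⁻¹)` for all `g` (gen 2's naturality
law `galoisSurjOf_natural` along `e`). [cite: MochizukiEtTh2009, Def 4.1 (ii) p.313 (PDF p.87)] -/
theorem galoisSurjOf_iso_conj (hG : IsTempered G) {X Y : BTemp G} (e : X ≅ Y) (hX : IsGaloisObj X)
    (hY : IsGaloisObj Y) : ∃ c : G, ∀ g : G,
      e.inv ≫ (galoisSurjOf hG X hX g).hom ≫ e.hom = (galoisSurjOf hG Y hY (c * g * c⁻¹)).hom := by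
  obtain ⟨c, hc⟩ := galoisSurjOf_natural hG hY hX e.hom
  refine ⟨c, fun g => ?_⟩
  rw [hc g, Iso.inv_hom_id_assoc]

/-! ### Transport along any functor isomorphic to `B^temp(φ)`, `φ` a continuous surjection -/

section IsoRes

/-- `F ≅ B^temp(φ)` of a continuous surjection carries Galois objects to Galois objects (the binder `hG` of
`Thm44Hyp.galoisCompatible_of` along `Ψ^bs ≅ B^temp(φ)`). [cite: MochizukiEtTh2009, Thm 4.4 (i) p.320 (PDF p.94)] -/
theorem isGaloisObj_of_iso_res (hG : IsTempered G) (hG₂ : IsTempered G₂) (φ : G₂ →ₜ* G)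
    (hφ : Function.Surjective φ) {F : BTemp G ⥤ BTemp G₂} (η : F ≅ BTemp.res φ) (A : BTemp G)
    (hA : IsGaloisObj A) : IsGaloisObj (F.obj A) :=
  isGaloisObj_of_iso hG₂ (η.app A) (isGaloisObj_res hG φ hφ A hA)

/-- **`Ker(galoisSurjOf_{F A}) = φ⁻¹ Ker(galoisSurjOf_A)` for any `F ≅ B^temp(φ)`** (T44-L09 in model form: for
`φ = θ⁻¹` an isomorphism, `θ(N_A) = N_{F A}`). [cite: MochizukiEtTh2009, Thm 4.4 (i) p.320 (PDF p.94)] -/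
theorem ker_galoisSurjOf_of_iso_res (hG : IsTempered G) (hG₂ : IsTempered G₂) (φ : G₂ →ₜ* G)
    (hφ : Function.Surjective φ) {F : BTemp G ⥤ BTemp G₂} (η : F ≅ BTemp.res φ) (A : BTemp G)
    (hA : IsGaloisObj A) (hFA : IsGaloisObj (F.obj A)) :
    (galoisSurjOf hG₂ (F.obj A) hFA).ker = (galoisSurjOf hG A hA).ker.comap φ.toMonoidHom := by
  rw [ker_galoisSurjOf_eq_of_iso hG₂ (η.app A) hFA (isGaloisObj_res hG φ hφ A hA)]
  exact ker_galoisSurjOf_res hG hG₂ φ hφ A hA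

/-- **TRANSPORT LAW along any `F ≅ B^temp(φ)`** (the binder `hT` of `Thm44Hyp.galoisCompatible_of` in model form):
there is `c ∈ Π₂` with `F(galoisSurjOf_A(φ h)) = galoisSurjOf_{F A}(c h c⁻¹)` for every `h ∈ Π₂` — gen 2's
`galoisSurjOf_res` moved along the isomorphism `η_A : F A ≅ B^temp(φ)(A)` by `galoisSurjOf_iso_conj`.
[cite: MochizukiEtTh2009, Thm 4.4 (i) p.320 (PDF p.94)] -/
theorem galoisSurjOf_of_iso_res (hG : IsTempered G) (hG₂ : IsTempered G₂) (φ : G₂ →ₜ* G)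
    (hφ : Function.Surjective φ) {F : BTemp G ⥤ BTemp G₂} (η : F ≅ BTemp.res φ) (A : BTemp G)
    (hA : IsGaloisObj A) (hFA : IsGaloisObj (F.obj A)) : ∃ c : G₂, ∀ h : G₂,
      F.map (galoisSurjOf hG A hA (φ h)).hom = (galoisSurjOf hG₂ (F.obj A) hFA (c * h * c⁻¹)).hom := by
  obtain ⟨c₁, hc₁⟩ := galoisSurjOf_res hG hG₂ φ hφ A hA
  obtain ⟨c₂, hc₂⟩ := galoisSurjOf_iso_conj hG₂ (η.app A) hFA (isGaloisObj_res hG φ hφ A hA)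
  -- `η_A⁻¹ ∘ gS_{F A}(k) ∘ η_A = gS_{res A}(c₂ k c₂⁻¹)`, i.e. `gS_{F A}(c₂⁻¹ m c₂) = η_A ∘ gS_{res A}(m) ∘ η_A⁻¹`
  refine ⟨c₂⁻¹ * c₁, fun h => ?_⟩
  have hnat : F.map (galoisSurjOf hG A hA (φ h)).hom =
      η.hom.app A ≫ (BTemp.res φ).map (galoisSurjOf hG A hA (φ h)).hom ≫ η.inv.app A := by
    rw [← Category.assoc, ← η.hom.naturality, Category.assoc, Iso.hom_inv_id_app, Category.comp_id]
  have h2 := hc₂ (c₂⁻¹ * (c₁ * h * c₁⁻¹) * c₂⁻¹⁻¹)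
  rw [show c₂ * (c₂⁻¹ * (c₁ * h * c₁⁻¹) * c₂⁻¹⁻¹) * c₂⁻¹ = c₁ * h * c₁⁻¹ by group,
    show c₂⁻¹ * (c₁ * h * c₁⁻¹) * c₂⁻¹⁻¹ = c₂⁻¹ * c₁ * h * (c₂⁻¹ * c₁)⁻¹ by group,
    Iso.app_inv, Iso.app_hom] at h2
  rw [hnat, hc₁ h, ← h2]
  simp only [Category.assoc, Iso.hom_inv_id_app_assoc, Iso.hom_inv_id_app, Category.comp_id]

end IsoRes

end GaloisObjects

end Literature.AnabelianGeometry.SemiGraphs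

end
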